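import Literature.Probability.Percolation.OneArmTraceIdentification
import Literature.Probability.Percolation.OneArmNeumannEstimate
import Literature.Analysis.Complex.ConformalRadiusKoebeDeficit
import Literature.Analysis.Complex.ConformalRadiusSemicontinuity
import HarnessLib

/-!
# LSW's Lemma 2.3 without harmonic measure: the renewal hypotheses from arc couplings (proofs only)

Topic `Probability/Percolation`; family `crit-perc`. Def-free, fact-free sequel of
`OneArmTraceIdentification.lean`, `OneArmNeumannEstimate.lean` and
`Literature/Analysis/Complex/ConformalRadiusKoebeDeficit.lean`, about the named facts
`LawlerSchrammWerner2002_hittingPDE`, `LawlerSchrammWerner2002_scalingLimitExponent` (LSW Thm. 1.2)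
and `oneArm_exponent` (LSW Thm. 1.1) of Lawler–Schramm–Werner, *One-arm exponent for critical 2D
percolation*, Electron. J. Probab. **7** (2002), paper no. 2.

`lswHit_two_pi_eq_measureReal_of_renewal` (`OneArmTraceIdentification.lean`) identifies the trace
`w_ν(t) = ν{K | 𝔯(K) ≤ e^{-t}}` of a probability measure `ν` on non-empty compacts with the series
solution `u(2π, ·)` from two hypotheses: domination `renewalST 6 1_{≤0} w_ν θ ≤ w_ν` on
`(0, 2π) × ℝ`, and from-below flatness of the renewal extension of the window averages of `w_ν` at
`θ = 2π` to order `o((2π - θ)^{1/3})`. LSW obtain both through the arc hulls `Q(θ) ⊆ Q(2π)`: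
domination is (2.10) (`h(θ, ·)` IS the renewal extension) with `h(θ, ·) ≤ h(2π, ·)`, and flatness
is Lemma 2.3, proved from the three-arm tail (2.13)–(2.14) and the harmonic-measure estimates
(2.15)–(2.16). This file proves that **couplings of the arc hulls with (2.10) and the tail (2.14)
suffice**, the harmonic-measure step being replaced by the Koebe-distortion deficit bound
`min{log 𝔯(K) - log 𝔯(K₂), 1} ≤ 2 √(32 r/ρ₀)` for `K ⊆ K₂ ⊆ K ∪ B̄(1, r)`, `𝔯(K) ≥ ρ₀`
(`min_log_conformalRadius_sub_log_le_of_subset_union`) and the window estimate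
`eventually_window_sub_ge_of_tail` (`OneArmNeumannEstimate.lean`):

* `measurable_conformalRadius_nonemptyCompacts` — `K ↦ 𝔯(K)` is Borel on the Hausdorff space
  (lower semicontinuity, `isClosed_setOf_conformalRadius_le`); `conformalRadius_pos_iff_zero_notMem`
  — `0 < 𝔯(K) ↔ 0 ∉ K` for non-empty compact `K`;
* `renewal_hypotheses_of_arcCoupling` — for a probability measure `ν` on non-empty compacts with
  `𝔯 > 0` a.s. and probability measures `μ_θ` on pairs `(K_θ, K_{2π})` (`θ ∈ (0, 2π)`) with second
  marginal `ν`, `K_θ ⊆ K_{2π}` a.s., **(2.10)** `μ_θ{𝔯(K_θ) ≤ e^{-s}} = renewalST 6 1_{≤0} w_ν θ s`,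
  and the **tail** `μ_θ{K_{2π} ⊄ K_θ ∪ B̄(1, r)} ≤ c ((2π - θ)/r)^γ` for `θ` near `2π`, `r > 0`,
  some `γ > 1` ((2.14) with `γ = 1 + α`): BOTH hypotheses of `lswHit_two_pi_eq_measureReal_of_renewal`
  hold;
* `lswHit_two_pi_eq_measureReal_of_arcCoupling` — hence `u(2π, t) = w_ν(t)` for `t > 0`;
* `exists_tendsto_subseq_pairLaw` — pair laws carried by `Ū × Ū` have weakly convergent
  subsequences (Prokhorov), so such couplings can be produced as joint subsequential limits
  (their a.s. inclusion, tails and second marginal then pass to the limit: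
  `OneArmArcCouplingLimit.lean`);
* `oneArm_exponent_of_subseqArcCoupling` — and `LawlerSchrammWerner2002_hittingPDE`,
  `LawlerSchrammWerner2002_scalingLimitExponent`, `oneArm_exponent` hold as soon as every
  subsequential weak limit `ν` of `lswLaw` admits such couplings (`oneArm_exponent_of_subseqRenewal`).

What this leaves of LSW §2 for the three facts is purely the construction of the couplings at the
subsequential limits: the joint limit law of `(Q_δ(θ), Q_δ(2π))` (tightness), its a.s. inclusion and
tail (2.14) (portmanteau on closed sets; (2.13) is `HalfPlaneThreeArm.lean`), `0 ∉ Q(2π)` a.s.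
(RSW), and (2.10) for its first marginal — LSW's Thm. 2.1 (Smirnov) with radial `SLE₆`
(2.5)–(2.9). No harmonic measure, no (2.15). No new definitions, no named facts.

## References

* G. F. Lawler, O. Schramm, W. Werner, *One-arm exponent for critical 2D percolation*, Electron.
  J. Probab. 7 (2002), no. 2: Thm. 2.1, (2.2), (2.10), Lemma 2.3 (2.12)–(2.16), proof of Thm. 1.2
  (pp. 3–8) [LawlerSchrammWernerEJP2002].

## Mathlib / tree

Tree: `lswHit_two_pi_eq_measureReal_of_renewal`, `oneArm_exponent_of_subseqRenewal`,
`renewalST_window`, `measurable_bottomDatum`, `bottomDatum_mem_Icc` (`OneArmTraceIdentification`,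
`OneArmRenewal`), `eventually_window_sub_ge_of_tail` (`OneArmNeumannEstimate`),
`min_log_conformalRadius_sub_log_le_of_subset_union` (`ConformalRadiusKoebeDeficit`),
`isClosed_setOf_conformalRadius_le` (`ConformalRadiusSemicontinuity`), `conformalRadius_mono`.
Mathlib: `measurable_of_Iic`, `ae_of_ae_map`, `measureReal_congr`, `map_measureReal_apply`,
`measureReal_union_le`, `ae_iff`.
-/

noncomputable section

open MeasureTheory Filter Topology Set Metric TopologicalSpace
open scoped NNReal ENNReal

namespace Literature.Probability.Percolation

open Literature.Analysis.Complex Literature.Probability.RandomPlanarGeometry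
  Literature.Probability.RandomPlanarGeometry.RadialLoewner

/-- **`K ↦ 𝔯(K)` is Borel measurable** on the Hausdorff space of non-empty compact subsets of
`ℂ` (the sublevel sets `{𝔯 ≤ ρ}` are closed, `isClosed_setOf_conformalRadius_le`).
[cite: LawlerSchrammWernerEJP2002, (2.2) (p. 4)] -/
theorem measurable_conformalRadius_nonemptyCompacts :
    Measurable fun K : NonemptyCompacts ℂ ↦ conformalRadius (K : Set ℂ) :=
  measurable_of_Iic fun ρ ↦ (isClosed_setOf_conformalRadius_le ρ).measurableSet

/-- For a closed non-empty `K ⊆ ℂ` with `0 ∉ K`, `𝔯(K) > 0` (`𝔯(K) ≥ min{dist(0, K), 1}`,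
`min_infDist_one_le_conformalRadius`). [folklore] -/
theorem conformalRadius_pos_of_zero_notMem {K : Set ℂ} (hK : IsClosed K) (hne : K.Nonempty)
    (h0 : (0 : ℂ) ∉ K) : 0 < conformalRadius K :=
  (lt_min ((hK.notMem_iff_infDist_pos hne).1 h0) one_pos).trans_le (min_infDist_one_le_conformalRadius K)

/-- On the Hausdorff space of non-empty compacts: `0 < 𝔯(K) ↔ 0 ∉ K` (so the hypothesis
"`𝔯 > 0` a.s." below is LSW's "`0 ∉ Q(θ)` a.s.", p. 4). [cite: LawlerSchrammWernerEJP2002, §2 (p. 4)] -/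
theorem conformalRadius_pos_iff_zero_notMem (K : NonemptyCompacts ℂ) :
    0 < conformalRadius (K : Set ℂ) ↔ (0 : ℂ) ∉ (K : Set ℂ) :=
  ⟨fun h h0 ↦ by rw [conformalRadius_eq_zero_of_mem h0] at h; exact lt_irrefl _ h,
    conformalRadius_pos_of_zero_notMem K.isCompact.isClosed K.nonempty⟩

section Coupling

variable (ν : ProbabilityMeasure (NonemptyCompacts ℂ))
  (μ : ℝ → ProbabilityMeasure (NonemptyCompacts ℂ × NonemptyCompacts ℂ))

/-- **The renewal hypotheses from arc couplings (LSW (2.10) + Lemma 2.3 without harmonic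
measure).** Let `ν` be a probability measure on non-empty compacts with `𝔯(K) > 0` for `ν`-a.e.
`K`, `w(s) = ν{K | 𝔯(K) ≤ e^{-s}}`, and for `θ ∈ (0, 2π)` let `μ_θ` be probability measures on
pairs `(K_θ, K_{2π})` with: second marginal `ν`; `K_θ ⊆ K_{2π}` a.s.; **(2.10)**
`μ_θ{𝔯(K_θ) ≤ e^{-s}} = renewalST 6 1_{≤0} w θ s` for all `s`; and for some `θ₁ < 2π`, `c`,
`γ > 1`, the **tail** `μ_θ{K_{2π} ⊄ K_θ ∪ B̄(1, r)} ≤ c ((2π - θ)/r)^γ` for `θ ∈ (θ₁, 2π)`,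
`r > 0`. Then (i) `renewalST 6 1_{≤0} w θ s ≤ w(s)` on `(0, 2π) × ℝ` (monotonicity of `𝔯`), and
(ii) for `L ∈ (0, 1)`, `t > 0`, `ε' > 0`, eventually as `θ ↑ 2π`,
`renewalST 6 (win_L 1_{≤0}) (win_L w) θ t - win_L w (t) ≥ -ε' (2π - θ)^{1/3}` (window averages
commute with the renewal extension; the Fubini bridge restricted to `{𝔯(K_θ) > e^{-(t+1)}}`; the
deficit bound; the tail at `r = (2π - θ)^{2γ/(1+2γ)}`). These are the hypotheses of
`lswHit_two_pi_eq_measureReal_of_renewal`.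
[cite: LawlerSchrammWernerEJP2002, §2: (2.10), Lemma 2.3 (2.12)–(2.16) (pp. 5–7)] -/
theorem renewal_hypotheses_of_arcCoupling
    (hpos : ∀ᵐ K ∂(ν : Measure (NonemptyCompacts ℂ)), 0 < conformalRadius ((K : NonemptyCompacts ℂ) : Set ℂ))
    (hsnd : ∀ θ ∈ Ioo 0 (2 * Real.pi),
      (μ θ : Measure (NonemptyCompacts ℂ × NonemptyCompacts ℂ)).map Prod.snd = ν)
    (hsub : ∀ θ ∈ Ioo 0 (2 * Real.pi), ∀ᵐ p ∂(μ θ : Measure (NonemptyCompacts ℂ × NonemptyCompacts ℂ)),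
      ((p.1 : NonemptyCompacts ℂ) : Set ℂ) ⊆ (p.2 : Set ℂ))
    (h210 : ∀ θ ∈ Ioo 0 (2 * Real.pi), ∀ s : ℝ,
      (μ θ : Measure (NonemptyCompacts ℂ × NonemptyCompacts ℂ)).real
          {p | conformalRadius ((p.1 : NonemptyCompacts ℂ) : Set ℂ) ≤ Real.exp (-s)} =
        renewalST 6 bottomDatum (fun s ↦ (ν : Measure (NonemptyCompacts ℂ)).real
          {K | conformalRadius (K : Set ℂ) ≤ Real.exp (-s)}) θ s)
    {θ₁ c γ : ℝ} (hθ₁ : θ₁ < 2 * Real.pi) (hγ : 1 < γ)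
    (htail : ∀ θ ∈ Ioo θ₁ (2 * Real.pi), ∀ r : ℝ, 0 < r →
      (μ θ : Measure (NonemptyCompacts ℂ × NonemptyCompacts ℂ)).real
          {p | ¬ (((p.2 : NonemptyCompacts ℂ) : Set ℂ) ⊆ (p.1 : Set ℂ) ∪ closedBall (1 : ℂ) r)} ≤
        c * ((2 * Real.pi - θ) / r) ^ γ) :
    (∀ θ ∈ Ioo 0 (2 * Real.pi), ∀ s : ℝ,
      renewalST 6 bottomDatum (fun s ↦ (ν : Measure (NonemptyCompacts ℂ)).real
        {K | conformalRadius (K : Set ℂ) ≤ Real.exp (-s)}) θ s ≤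
        (ν : Measure (NonemptyCompacts ℂ)).real {K | conformalRadius (K : Set ℂ) ≤ Real.exp (-s)}) ∧
    ∀ L ∈ Ioo (0 : ℝ) 1, ∀ t : ℝ, 0 < t → ∀ ε : ℝ, 0 < ε → ∀ᶠ θ in 𝓝[<] (2 * Real.pi),
      -(ε * (2 * Real.pi - θ) ^ (1 / 3 : ℝ)) ≤
        renewalST 6 (fun s ↦ ∫ r in (0 : ℝ)..L, bottomDatum (s + r))
          (fun s ↦ ∫ r in (0 : ℝ)..L, (ν : Measure (NonemptyCompacts ℂ)).real
            {K | conformalRadius (K : Set ℂ) ≤ Real.exp (-(s + r))}) θ t -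
        ∫ r in (0 : ℝ)..L, (ν : Measure (NonemptyCompacts ℂ)).real
            {K | conformalRadius (K : Set ℂ) ≤ Real.exp (-(t + r))} := by
  -- notation
  set w : ℝ → ℝ := fun s ↦ (ν : Measure (NonemptyCompacts ℂ)).real
    {K | conformalRadius (K : Set ℂ) ≤ Real.exp (-s)} with hwdef
  set R₁ : NonemptyCompacts ℂ × NonemptyCompacts ℂ → ℝ := fun p ↦ conformalRadius ((p.1 : NonemptyCompacts ℂ) : Set ℂ)
    with hR₁
  set R₂ : NonemptyCompacts ℂ × NonemptyCompacts ℂ → ℝ := fun p ↦ conformalRadius ((p.2 : NonemptyCompacts ℂ) : Set ℂ)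
    with hR₂
  have hR₁m : Measurable R₁ := measurable_conformalRadius_nonemptyCompacts.comp measurable_fst
  have hR₂m : Measurable R₂ := measurable_conformalRadius_nonemptyCompacts.comp measurable_snd
  -- the patched variables `0 < X₂ ≤ X₁`, a.s. equal to `R₂, R₁`
  set X₂ : NonemptyCompacts ℂ × NonemptyCompacts ℂ → ℝ := fun p ↦ if 0 < R₂ p then R₂ p else 1 with hX₂
  set X₁ : NonemptyCompacts ℂ × NonemptyCompacts ℂ → ℝ := fun p ↦ if 0 < R₂ p then max (R₁ p) (R₂ p) else 1
    with hX₁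
  have hmspos : MeasurableSet {p : NonemptyCompacts ℂ × NonemptyCompacts ℂ | 0 < R₂ p} :=
    measurableSet_lt measurable_const hR₂m
  have hX₂m : Measurable X₂ := Measurable.ite hmspos hR₂m measurable_const
  have hX₁m : Measurable X₁ := Measurable.ite hmspos (hR₁m.max hR₂m) measurable_const
  have hX₂pos : ∀ p, 0 < X₂ p := fun p ↦ by
    simp only [hX₂]; split_ifs with h
    · exact h
    · exact one_pos
  have hX₂le : ∀ p, X₂ p ≤ X₁ p := fun p ↦ by
    simp only [hX₂, hX₁]; split_ifs
    · exact le_max_right _ _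
    · exact le_rfl
  -- the good set and its full measure
  have hgood : ∀ θ ∈ Ioo 0 (2 * Real.pi), ∀ᵐ p ∂(μ θ : Measure (NonemptyCompacts ℂ × NonemptyCompacts ℂ)),
      ((p.1 : NonemptyCompacts ℂ) : Set ℂ) ⊆ (p.2 : Set ℂ) ∧ 0 < R₂ p := by
    intro θ hθ
    have h2 : ∀ᵐ p ∂(μ θ : Measure (NonemptyCompacts ℂ × NonemptyCompacts ℂ)), 0 < R₂ p := by
      have hmap : ∀ᵐ K ∂((μ θ : Measure (NonemptyCompacts ℂ × NonemptyCompacts ℂ)).map Prod.snd),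
          0 < conformalRadius ((K : NonemptyCompacts ℂ) : Set ℂ) := by rw [hsnd θ hθ]; exact hpos
      exact ae_of_ae_map measurable_snd.aemeasurable hmap
    filter_upwards [hsub θ hθ, h2] with p h1 h2 using ⟨h1, h2⟩
  have hX_good : ∀ p : NonemptyCompacts ℂ × NonemptyCompacts ℂ,
      (((p.1 : NonemptyCompacts ℂ) : Set ℂ) ⊆ (p.2 : Set ℂ) ∧ 0 < R₂ p) → X₁ p = R₁ p ∧ X₂ p = R₂ p := by
    rintro p ⟨hsub', hpos'⟩
    have hmono : R₂ p ≤ R₁ p := conformalRadius_mono hsub'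
    refine ⟨?_, ?_⟩
    · simp only [hX₁, if_pos hpos', max_eq_left hmono]
    · simp only [hX₂, if_pos hpos']
  -- a.s. equality of the level sets
  have hlevel : ∀ θ ∈ Ioo 0 (2 * Real.pi), ∀ s : ℝ,
      ({p | X₁ p ≤ Real.exp (-s)} =ᵐ[(μ θ : Measure (NonemptyCompacts ℂ × NonemptyCompacts ℂ))]
        {p | R₁ p ≤ Real.exp (-s)}) ∧
      ({p | X₂ p ≤ Real.exp (-s)} =ᵐ[(μ θ : Measure (NonemptyCompacts ℂ × NonemptyCompacts ℂ))]
        {p | R₂ p ≤ Real.exp (-s)}) := by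
    intro θ hθ s
    constructor
    · filter_upwards [hgood θ hθ] with p hp
      have := (hX_good p hp).1
      show (p ∈ {p | X₁ p ≤ Real.exp (-s)}) = (p ∈ {p | R₁ p ≤ Real.exp (-s)})
      simp only [mem_setOf_eq, this]
    · filter_upwards [hgood θ hθ] with p hp
      have := (hX_good p hp).2
      show (p ∈ {p | X₂ p ≤ Real.exp (-s)}) = (p ∈ {p | R₂ p ≤ Real.exp (-s)})
      simp only [mem_setOf_eq, this]
  -- the laws: `μ_θ{X₂ ≤ e^{-s}} = w s`, `μ_θ{X₁ ≤ e^{-s}} = renewalST … θ s`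
  have hlawX₂ : ∀ θ ∈ Ioo 0 (2 * Real.pi), ∀ s : ℝ,
      (μ θ : Measure (NonemptyCompacts ℂ × NonemptyCompacts ℂ)).real {p | X₂ p ≤ Real.exp (-s)} = w s := by
    intro θ hθ s
    rw [measureReal_congr (hlevel θ hθ s).2]
    have hS : MeasurableSet {K : NonemptyCompacts ℂ | conformalRadius (K : Set ℂ) ≤ Real.exp (-s)} :=
      measurableSet_le measurable_conformalRadius_nonemptyCompacts measurable_const
    have := map_measureReal_apply (μ := (μ θ : Measure (NonemptyCompacts ℂ × NonemptyCompacts ℂ)))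
      measurable_snd hS
    rw [hsnd θ hθ] at this
    simp only [hwdef]
    rw [this]
    rfl
  have hlawX₁ : ∀ θ ∈ Ioo 0 (2 * Real.pi), ∀ s : ℝ,
      (μ θ : Measure (NonemptyCompacts ℂ × NonemptyCompacts ℂ)).real {p | X₁ p ≤ Real.exp (-s)} =
        renewalST 6 bottomDatum w θ s := by
    intro θ hθ s
    rw [measureReal_congr (hlevel θ hθ s).1]
    exact h210 θ hθ s
  -- (i) domination
  have hdom : ∀ θ ∈ Ioo 0 (2 * Real.pi), ∀ s : ℝ, renewalST 6 bottomDatum w θ s ≤ w s := by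
    intro θ hθ s
    rw [← hlawX₁ θ hθ s, ← hlawX₂ θ hθ s]
    exact measureReal_mono (fun p (hp : X₁ p ≤ Real.exp (-s)) ↦ (hX₂le p).trans hp)
  refine ⟨hdom, ?_⟩
  -- (ii) flatness from below
  intro L hL t ht ε hε
  -- the tail at the level of `X₁, X₂`
  set θ₂ : ℝ := max θ₁ Real.pi with hθ₂
  have hθ₂lt : θ₂ < 2 * Real.pi := max_lt hθ₁ (by linarith [Real.pi_pos])
  have hθ₂sub : Ioo θ₂ (2 * Real.pi) ⊆ Ioo 0 (2 * Real.pi) := fun θ hθ ↦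
    ⟨(Real.pi_pos.trans_le (le_max_right θ₁ Real.pi)).trans hθ.1, hθ.2⟩
  have htailX : ∀ θ ∈ Ioo θ₂ (2 * Real.pi), ∀ ρ₀ : ℝ, 0 < ρ₀ → ∀ r : ℝ, 0 < r →
      (μ θ : Measure (NonemptyCompacts ℂ × NonemptyCompacts ℂ)).real {p | ρ₀ < X₁ p ∧
        2 * Real.sqrt (32 * r / ρ₀) < min (Real.log (X₁ p) - Real.log (X₂ p)) 1} ≤
        c * ((2 * Real.pi - θ) / r) ^ γ := by
    intro θ hθ ρ₀ hρ₀ r hr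
    have hθ' : θ ∈ Ioo 0 (2 * Real.pi) := hθ₂sub hθ
    have hθ'' : θ ∈ Ioo θ₁ (2 * Real.pi) := ⟨(le_max_left _ _).trans_lt hθ.1, hθ.2⟩
    set S := {p : NonemptyCompacts ℂ × NonemptyCompacts ℂ | ρ₀ < X₁ p ∧
      2 * Real.sqrt (32 * r / ρ₀) < min (Real.log (X₁ p) - Real.log (X₂ p)) 1} with hSdef
    set T := {p : NonemptyCompacts ℂ × NonemptyCompacts ℂ |
      ¬ (((p.2 : NonemptyCompacts ℂ) : Set ℂ) ⊆ (p.1 : Set ℂ) ∪ closedBall (1 : ℂ) r)} with hTdef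
    set G := {p : NonemptyCompacts ℂ × NonemptyCompacts ℂ |
      ((p.1 : NonemptyCompacts ℂ) : Set ℂ) ⊆ (p.2 : Set ℂ) ∧ 0 < R₂ p} with hGdef
    have hSTG : S ⊆ T ∪ Gᶜ := by
      intro p hp
      by_cases hG : p ∈ G
      · left
        intro hcontra
        obtain ⟨h1, h2⟩ := hX_good p hG
        rw [hSdef, mem_setOf_eq, h1, h2] at hp
        have hone : (1 : ℝ) ≤ ‖(1 : ℂ)‖ := by simp
        have := (min_log_conformalRadius_sub_log_le_of_subset_union hone hr.le hG.1 hcontra hρ₀ hp.1.le).1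
        linarith [hp.2]
      · right; exact hG
    have hGc : (μ θ : Measure (NonemptyCompacts ℂ × NonemptyCompacts ℂ)).real Gᶜ = 0 := by
      have h0 : (μ θ : Measure (NonemptyCompacts ℂ × NonemptyCompacts ℂ)) Gᶜ = 0 := by
        have := hgood θ hθ'
        rw [ae_iff] at this
        rw [hGdef, compl_setOf]
        exact this
      simp [Measure.real, h0]
    calc (μ θ : Measure (NonemptyCompacts ℂ × NonemptyCompacts ℂ)).real S
        ≤ (μ θ : Measure (NonemptyCompacts ℂ × NonemptyCompacts ℂ)).real (T ∪ Gᶜ) := measureReal_mono hSTG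
      _ ≤ (μ θ : Measure (NonemptyCompacts ℂ × NonemptyCompacts ℂ)).real T +
            (μ θ : Measure (NonemptyCompacts ℂ × NonemptyCompacts ℂ)).real Gᶜ := measureReal_union_le _ _
      _ = (μ θ : Measure (NonemptyCompacts ℂ × NonemptyCompacts ℂ)).real T := by rw [hGc, add_zero]
      _ ≤ c * ((2 * Real.pi - θ) / r) ^ γ := htail θ hθ'' r hr
  -- the clamped family of measures (so that the law of `X₂` is `w` for every real parameter)
  set cl : ℝ → ℝ := fun θ ↦ if θ ∈ Ioo 0 (2 * Real.pi) then θ else Real.pi with hcl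
  have hcl_mem : ∀ θ, cl θ ∈ Ioo 0 (2 * Real.pi) := fun θ ↦ by
    simp only [hcl]; split_ifs with h
    · exact h
    · exact ⟨Real.pi_pos, by linarith [Real.pi_pos]⟩
  have hcl_id : ∀ θ ∈ Ioo 0 (2 * Real.pi), cl θ = θ := fun θ hθ ↦ by simp only [hcl, if_pos hθ]
  set P : ℝ → Measure (NonemptyCompacts ℂ × NonemptyCompacts ℂ) := fun θ ↦ (μ (cl θ) : Measure _) with hP
  haveI : ∀ θ, IsProbabilityMeasure (P θ) := fun θ ↦ by simp only [hP]; infer_instance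
  have hwP : ∀ θ s, (P θ).real {p | X₂ p ≤ Real.exp (-s)} = w s := fun θ s ↦ hlawX₂ (cl θ) (hcl_mem θ) s
  have htailP : ∀ θ ∈ Ioo θ₂ (2 * Real.pi), ∀ ρ₀ : ℝ, 0 < ρ₀ → ∀ r : ℝ, 0 < r →
      (P θ).real {p | ρ₀ < X₁ p ∧ 2 * Real.sqrt (32 * r / ρ₀) < min (Real.log (X₁ p) - Real.log (X₂ p)) 1} ≤
        c * ((2 * Real.pi - θ) / r) ^ γ := by
    intro θ hθ ρ₀ hρ₀ r hr
    simp only [hP, hcl_id θ (hθ₂sub hθ)]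
    exact htailX θ hθ ρ₀ hρ₀ r hr
  have hev := eventually_window_sub_ge_of_tail P (X₁ := fun _ ↦ X₁) (fun _ ↦ hX₁m) hX₂m hX₂pos
    (fun _ ↦ hX₂le) hwP hθ₂lt hγ htailP hL.2.le t hε
  -- rewrite the renewal extension of the window averages as the window average of `μ_θ{X₁ ≤ e^{-·}}`
  have hwm : Measurable w := by
    refine Antitone.measurable fun a b hab ↦ ?_
    exact measureReal_mono fun K (hK : conformalRadius _ ≤ Real.exp (-b)) ↦
      hK.trans (Real.exp_le_exp.2 (neg_le_neg hab))
  have hwb : ∀ s, |w s| ≤ 1 := fun s ↦ by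
    rw [abs_of_nonneg measureReal_nonneg]; exact measureReal_le_one
  have hbb : ∀ s, |bottomDatum s| ≤ 1 := fun s ↦ by
    have := bottomDatum_mem_Icc s; rw [abs_of_nonneg this.1]; exact this.2
  have hmemI : Ioo 0 (2 * Real.pi) ∈ 𝓝[<] (2 * Real.pi) := Ioo_mem_nhdsLT (by linarith [Real.pi_pos])
  filter_upwards [hev, hmemI] with θ hθev hθI
  have hwin := renewalST_window (6 : ℝ≥0) measurable_bottomDatum hwm hbb hwb θ t hL.1.le
  have hint : (∫ r in (0 : ℝ)..L, renewalST 6 bottomDatum w θ (t + r)) =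
      ∫ r in (0 : ℝ)..L, (P θ).real {p | X₁ p ≤ Real.exp (-(t + r))} := by
    refine intervalIntegral.integral_congr fun r _ ↦ ?_
    simp only [hP, hcl_id θ hθI]
    exact (hlawX₁ θ hθI (t + r)).symm
  show -(ε * (2 * Real.pi - θ) ^ (1 / 3 : ℝ)) ≤
    renewalST 6 (fun s ↦ ∫ r in (0 : ℝ)..L, bottomDatum (s + r)) (fun s ↦ ∫ r in (0 : ℝ)..L, w (s + r)) θ t -
      ∫ r in (0 : ℝ)..L, w (t + r)
  rw [hwin, hint]
  exact hθev

/-- **The trace identification from arc couplings**: under the hypotheses of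
`renewal_hypotheses_of_arcCoupling`, `u(2π, t) = ν{K | 𝔯(K) ≤ e^{-t}}` for all `t > 0`
(`u = lswHit 6`; `lswHit_two_pi_eq_measureReal_of_renewal`).
[cite: LawlerSchrammWernerEJP2002, §2: Thm. 2.1, (2.10), Lemma 2.2, Lemma 2.3] -/
theorem lswHit_two_pi_eq_measureReal_of_arcCoupling
    (hpos : ∀ᵐ K ∂(ν : Measure (NonemptyCompacts ℂ)), 0 < conformalRadius ((K : NonemptyCompacts ℂ) : Set ℂ))
    (hsnd : ∀ θ ∈ Ioo 0 (2 * Real.pi),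
      (μ θ : Measure (NonemptyCompacts ℂ × NonemptyCompacts ℂ)).map Prod.snd = ν)
    (hsub : ∀ θ ∈ Ioo 0 (2 * Real.pi), ∀ᵐ p ∂(μ θ : Measure (NonemptyCompacts ℂ × NonemptyCompacts ℂ)),
      ((p.1 : NonemptyCompacts ℂ) : Set ℂ) ⊆ (p.2 : Set ℂ))
    (h210 : ∀ θ ∈ Ioo 0 (2 * Real.pi), ∀ s : ℝ,
      (μ θ : Measure (NonemptyCompacts ℂ × NonemptyCompacts ℂ)).real
          {p | conformalRadius ((p.1 : NonemptyCompacts ℂ) : Set ℂ) ≤ Real.exp (-s)} =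
        renewalST 6 bottomDatum (fun s ↦ (ν : Measure (NonemptyCompacts ℂ)).real
          {K | conformalRadius (K : Set ℂ) ≤ Real.exp (-s)}) θ s)
    {θ₁ c γ : ℝ} (hθ₁ : θ₁ < 2 * Real.pi) (hγ : 1 < γ)
    (htail : ∀ θ ∈ Ioo θ₁ (2 * Real.pi), ∀ r : ℝ, 0 < r →
      (μ θ : Measure (NonemptyCompacts ℂ × NonemptyCompacts ℂ)).real
          {p | ¬ (((p.2 : NonemptyCompacts ℂ) : Set ℂ) ⊆ (p.1 : Set ℂ) ∪ closedBall (1 : ℂ) r)} ≤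
        c * ((2 * Real.pi - θ) / r) ^ γ)
    {t : ℝ} (ht : 0 < t) :
    lswHit 6 (2 * Real.pi) t =
      (ν : Measure (NonemptyCompacts ℂ)).real {K | conformalRadius (K : Set ℂ) ≤ Real.exp (-t)} := by
  obtain ⟨hdom, hfl⟩ := renewal_hypotheses_of_arcCoupling ν μ hpos hsnd hsub h210 hθ₁ hγ htail
  exact lswHit_two_pi_eq_measureReal_of_renewal ν hdom hfl ht

end Coupling

/-- **Joint subsequential limits of pair laws exist**: a sequence of probability measures on
`NonemptyCompacts ℂ × NonemptyCompacts ℂ` carried by the pairs of subsets of the closed unit disc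
(`subUnitDisc ×ˢ subUnitDisc`, e.g. the joint laws of `(Q_δ(θ), Q_δ(2π))`) has a weakly convergent
subsequence (tightness on one compact set; Prokhorov, `isCompact_closure_of_isTightMeasureSet`).
[cite: LawlerSchrammWernerEJP2002, §2 (p. 3)] -/
theorem exists_tendsto_subseq_pairLaw
    (P : ℕ → ProbabilityMeasure (NonemptyCompacts ℂ × NonemptyCompacts ℂ))
    (hP : ∀ k, (P k : Measure (NonemptyCompacts ℂ × NonemptyCompacts ℂ)) (subUnitDisc ×ˢ subUnitDisc)ᶜ = 0) :
    ∃ μ : ProbabilityMeasure (NonemptyCompacts ℂ × NonemptyCompacts ℂ), ∃ φ : ℕ → ℕ, StrictMono φ ∧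
      Tendsto (P ∘ φ) atTop (𝓝 μ) := by
  have htight : IsTightMeasureSet
      {m : Measure (NonemptyCompacts ℂ × NonemptyCompacts ℂ) | ∃ k, (P k : Measure _) = m} := by
    rw [isTightMeasureSet_iff_exists_isCompact_measure_compl_le]
    intro ε _
    refine ⟨subUnitDisc ×ˢ subUnitDisc, isCompact_subUnitDisc.prod isCompact_subUnitDisc, ?_⟩
    rintro m ⟨k, rfl⟩
    rw [hP k]
    exact zero_le
  have hcomp : IsCompact (closure (range P)) := by
    apply isCompact_closure_of_isTightMeasureSet
    refine htight.subset ?_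
    rintro _ ⟨m, ⟨k, rfl⟩, rfl⟩
    exact ⟨k, rfl⟩
  obtain ⟨μ, -, φ, hφ, hconv⟩ := hcomp.tendsto_subseq (x := P) fun n ↦ subset_closure ⟨n, rfl⟩
  exact ⟨μ, φ, hφ, hconv⟩

/-- **`LawlerSchrammWerner2002_hittingPDE`, LSW Thm. 1.2 and Thm. 1.1 from arc couplings at the
subsequential weak limits.** If every weak limit `ν` of `lswLaw (R_k)`, `R_k → ∞`, has `𝔯 > 0`
a.s. and admits, for `θ ∈ (0, 2π)`, couplings `μ_θ` of `(K_θ, K_{2π})` with second marginal `ν`,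
`K_θ ⊆ K_{2π}` a.s., LSW's (2.10) for the first marginal, and the tail (2.14)
`μ_θ{K_{2π} ⊄ K_θ ∪ B̄(1, r)} ≤ c ((2π - θ)/r)^γ` (`γ > 1`, `θ` near `2π`, `r > 0`), then the named
fact `LawlerSchrammWerner2002_hittingPDE`, `LawlerSchrammWerner2002_scalingLimitExponent` and
`oneArm_exponent` hold (`oneArm_exponent_of_subseqRenewal`). No harmonic measure is needed.
[cite: LawlerSchrammWernerEJP2002, Thm. 1.1, Thm. 1.2, §2 (Thm. 2.1, (2.10), Lemma 2.3)] -/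
theorem oneArm_exponent_of_subseqArcCoupling
    (h : ∀ (R : ℕ → ℝ) (ν : ProbabilityMeasure (NonemptyCompacts ℂ)),
      Tendsto R atTop atTop → Tendsto (lswLaw ∘ R) atTop (𝓝 ν) →
      (∀ᵐ K ∂(ν : Measure (NonemptyCompacts ℂ)), 0 < conformalRadius ((K : NonemptyCompacts ℂ) : Set ℂ)) ∧
      ∃ μ : ℝ → ProbabilityMeasure (NonemptyCompacts ℂ × NonemptyCompacts ℂ),
        (∀ θ ∈ Ioo 0 (2 * Real.pi),
          (μ θ : Measure (NonemptyCompacts ℂ × NonemptyCompacts ℂ)).map Prod.snd = ν) ∧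
        (∀ θ ∈ Ioo 0 (2 * Real.pi), ∀ᵐ p ∂(μ θ : Measure (NonemptyCompacts ℂ × NonemptyCompacts ℂ)),
          ((p.1 : NonemptyCompacts ℂ) : Set ℂ) ⊆ (p.2 : Set ℂ)) ∧
        (∀ θ ∈ Ioo 0 (2 * Real.pi), ∀ s : ℝ,
          (μ θ : Measure (NonemptyCompacts ℂ × NonemptyCompacts ℂ)).real
              {p | conformalRadius ((p.1 : NonemptyCompacts ℂ) : Set ℂ) ≤ Real.exp (-s)} =
            renewalST 6 bottomDatum (fun s ↦ (ν : Measure (NonemptyCompacts ℂ)).real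
              {K | conformalRadius (K : Set ℂ) ≤ Real.exp (-s)}) θ s) ∧
        ∃ θ₁ c γ : ℝ, θ₁ < 2 * Real.pi ∧ 1 < γ ∧
          ∀ θ ∈ Ioo θ₁ (2 * Real.pi), ∀ r : ℝ, 0 < r →
            (μ θ : Measure (NonemptyCompacts ℂ × NonemptyCompacts ℂ)).real
                {p | ¬ (((p.2 : NonemptyCompacts ℂ) : Set ℂ) ⊆ (p.1 : Set ℂ) ∪ closedBall (1 : ℂ) r)} ≤
              c * ((2 * Real.pi - θ) / r) ^ γ) :
    LawlerSchrammWerner2002_hittingPDE ∧ LawlerSchrammWerner2002_scalingLimitExponent ∧ oneArm_exponent := by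
  refine oneArm_exponent_of_subseqRenewal fun R ν hR hν ↦ ?_
  obtain ⟨hpos, μ, hsnd, hsub, h210, θ₁, c, γ, hθ₁, hγ, htail⟩ := h R ν hR hν
  exact renewal_hypotheses_of_arcCoupling ν μ hpos hsnd hsub h210 hθ₁ hγ htail

end Literature.Probability.Percolation
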